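import Mathlib

/-!
# Route `BECRieszReverseHolder` — support item `TwoScaleGlue` (stmt-AtomisticToContinuum-12843):
# cube-form Hölder lemmas

Abstract `[0, ∞]`-valued inequalities used by the two-scale glue
`Theorems/BECRieszReverseHolderTwoScaleGlue.lean` (helper file, `--supports` the item):

* `mul_lintegral_pow_three_le` — three-factor Hölder in cube form: if `c · u³ ≤ f · g · h` almost
  everywhere (finite constant `c`) then `c · (∫ u)³ ≤ (∫ f)(∫ g)(∫ h)`
  (`ENNReal.lintegral_prod_norm_pow_le` with the three exponents `1/3`);
* `mul_sum_pow_three_le` — the same for finite sums (the integral version over the counting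
  measure);
* `key_finite` — the pointwise two-scale inequality on one slice in abstract form: for cube masses
  `w_k`, cube `L¹`-masses `s_k` and a threshold `c`, discarding the bad cubes `{k | s_k² < c w_k}`,
  `c · (∑ w − ∑_{bad} w)³ ≤ (∑ s)² · ∑ w²` (from `c w_k ≤ s_k²` on the good cubes and the finite
  three-factor Hölder).

Elementary real analysis (Hölder's inequality); no named facts.
-/

noncomputable section

open MeasureTheory
open scoped ENNReal NNReal

namespace Summit.AtomisticToContinuum.BoseEinsteinCondensation.Theorems.TwoScaleGlueProof

/-- **Three-factor Hölder, cube form.** If `c · u³ ≤ f · g · h` almost everywhere (with a finite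
constant `c`), then `c · (∫ u)³ ≤ (∫ f)(∫ g)(∫ h)`: pointwise `c^{1/3} u ≤ f^{1/3} g^{1/3} h^{1/3}`,
then Hölder with exponents `(3, 3, 3)` (`ENNReal.lintegral_prod_norm_pow_le`). [folklore] -/
theorem mul_lintegral_pow_three_le {α : Type*} [MeasurableSpace α] {μ : Measure α} {c : ℝ≥0∞}
    (hc : c ≠ ⊤) {u f g h : α → ℝ≥0∞} (hf : AEMeasurable f μ) (hg : AEMeasurable g μ)
    (hh : AEMeasurable h μ) (hu : ∀ᵐ x ∂μ, c * u x ^ 3 ≤ f x * g x * h x) :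
    c * (∫⁻ x, u x ∂μ) ^ 3 ≤ (∫⁻ x, f x ∂μ) * (∫⁻ x, g x ∂μ) * (∫⁻ x, h x ∂μ) := by
  have h3 : (0 : ℝ) ≤ 1 / 3 := by norm_num
  -- cube roots undo cubes and conversely
  have rpow_third_pow_three : ∀ x : ℝ≥0∞, (x ^ (1 / 3 : ℝ)) ^ 3 = x := fun x => by
    rw [← ENNReal.rpow_natCast, ← ENNReal.rpow_mul]
    norm_num
  have pow_three_rpow_third : ∀ x : ℝ≥0∞, (x ^ 3) ^ (1 / 3 : ℝ) = x := fun x => by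
    rw [← ENNReal.rpow_natCast, ← ENNReal.rpow_mul]
    norm_num
  -- pointwise cube roots
  have hpt : ∀ᵐ x ∂μ, c ^ (1 / 3 : ℝ) * u x ≤
      f x ^ (1 / 3 : ℝ) * g x ^ (1 / 3 : ℝ) * h x ^ (1 / 3 : ℝ) := by
    filter_upwards [hu] with x hx
    have := ENNReal.rpow_le_rpow hx h3
    rwa [ENNReal.mul_rpow_of_nonneg _ _ h3, pow_three_rpow_third,
      ENNReal.mul_rpow_of_nonneg _ _ h3, ENNReal.mul_rpow_of_nonneg _ _ h3] at this
  -- Hölder with three factors of exponent `3`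
  have hH : ∫⁻ x, f x ^ (1 / 3 : ℝ) * g x ^ (1 / 3 : ℝ) * h x ^ (1 / 3 : ℝ) ∂μ ≤
      (∫⁻ x, f x ∂μ) ^ (1 / 3 : ℝ) * (∫⁻ x, g x ∂μ) ^ (1 / 3 : ℝ) *
        (∫⁻ x, h x ∂μ) ^ (1 / 3 : ℝ) := by
    have key := ENNReal.lintegral_prod_norm_pow_le (μ := μ) Finset.univ (f := ![f, g, h])
      (p := fun _ => (1 / 3 : ℝ)) ?_ ?_ ?_
    · simpa [Fin.prod_univ_three, mul_assoc] using key
    · intro i _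
      fin_cases i
      · simpa using hf
      · simpa using hg
      · simpa using hh
    · simp only [Finset.sum_const, Finset.card_univ, Fintype.card_fin, nsmul_eq_mul]
      norm_num
    · intro i _
      norm_num
  have hc3 : c ^ (1 / 3 : ℝ) ≠ ⊤ := ENNReal.rpow_ne_top_of_nonneg h3 hc
  calc c * (∫⁻ x, u x ∂μ) ^ 3 = (c ^ (1 / 3 : ℝ) * ∫⁻ x, u x ∂μ) ^ 3 := by
        rw [mul_pow, rpow_third_pow_three]
    _ = (∫⁻ x, c ^ (1 / 3 : ℝ) * u x ∂μ) ^ 3 := by rw [lintegral_const_mul' _ _ hc3]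
    _ ≤ (∫⁻ x, f x ^ (1 / 3 : ℝ) * g x ^ (1 / 3 : ℝ) * h x ^ (1 / 3 : ℝ) ∂μ) ^ 3 :=
        pow_le_pow_left' (lintegral_mono_ae hpt) 3
    _ ≤ ((∫⁻ x, f x ∂μ) ^ (1 / 3 : ℝ) * (∫⁻ x, g x ∂μ) ^ (1 / 3 : ℝ) *
          (∫⁻ x, h x ∂μ) ^ (1 / 3 : ℝ)) ^ 3 :=
        pow_le_pow_left' hH 3
    _ = (∫⁻ x, f x ∂μ) * (∫⁻ x, g x ∂μ) * (∫⁻ x, h x ∂μ) := by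
        rw [mul_pow, mul_pow, rpow_third_pow_three, rpow_third_pow_three, rpow_third_pow_three]

/-- **Three-factor Hölder for finite sums, cube form**: `c · (∑ u)³ ≤ (∑ f)(∑ g)(∑ h)` whenever
`c · u_k³ ≤ f_k g_k h_k` for every `k` (the integral version over the counting measure). [folklore] -/
theorem mul_sum_pow_three_le {ι : Type*} [Fintype ι] {c : ℝ≥0∞} (hc : c ≠ ⊤)
    {u f g h : ι → ℝ≥0∞} (hu : ∀ k, c * u k ^ 3 ≤ f k * g k * h k) :
    c * (∑ k, u k) ^ 3 ≤ (∑ k, f k) * (∑ k, g k) * (∑ k, h k) := by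
  letI : MeasurableSpace ι := ⊤
  haveI : MeasurableSingletonClass ι := ⟨fun _ => MeasurableSpace.measurableSet_top⟩
  have hm : ∀ v : ι → ℝ≥0∞, AEMeasurable v Measure.count := fun v =>
    (show Measurable v from fun _ _ => MeasurableSpace.measurableSet_top).aemeasurable
  have key := mul_lintegral_pow_three_le (μ := Measure.count) hc (u := u) (hm f) (hm g) (hm h)
    (ae_of_all _ hu)
  simpa only [lintegral_fintype, Measure.count_singleton, mul_one] using key

/-- **The pointwise two-scale inequality** (one slice `X̂` fixed; `w_k`, `s_k` the cube masses of
`Ψ²` and `Ψ`): with the bad cubes `{k | s_k² < c w_k}` removed from the total mass,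
`c · (∑ w − ∑_{bad} w)³ ≤ (∑ s)² · ∑ w²` — from `c w_k ≤ s_k²` on good cubes and the finite
three-factor Hölder `∑_G w = ∑_G (s s w²/c)^{1/3}`. [folklore] -/
theorem key_finite {ι : Type*} [Fintype ι] {c : ℝ≥0∞} (hc : c ≠ ⊤) (w s : ι → ℝ≥0∞) :
    c * (∑ k, w k - ∑ k, if s k ^ 2 < c * w k then w k else 0) ^ 3 ≤
      (∑ k, s k) ^ 2 * ∑ k, w k ^ 2 := by
  classical
  -- good part of the mass
  set w' : ι → ℝ≥0∞ := fun k => if s k ^ 2 < c * w k then 0 else w k with hw'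
  have hsplit : ∑ k, w k = ∑ k, w' k + ∑ k, (if s k ^ 2 < c * w k then w k else 0) := by
    rw [← Finset.sum_add_distrib]
    refine Finset.sum_congr rfl fun k _ => ?_
    by_cases hk : s k ^ 2 < c * w k <;> simp [hw', hk]
  have hsub : ∑ k, w k - ∑ k, (if s k ^ 2 < c * w k then w k else 0) ≤ ∑ k, w' k := by
    rw [hsplit]
    exact add_tsub_le_right
  -- cube Hölder on the good part
  have hH : c * (∑ k, w' k) ^ 3 ≤ (∑ k, s k) * (∑ k, s k) * ∑ k, w' k ^ 2 := by
    refine mul_sum_pow_three_le hc fun k => ?_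
    by_cases hk : s k ^ 2 < c * w k
    · simp [hw', hk]
    · have hk' : c * w k ≤ s k ^ 2 := not_lt.1 hk
      simp only [hw', hk, if_false]
      calc c * w k ^ 3 = c * w k * w k ^ 2 := by ring
        _ ≤ s k ^ 2 * w k ^ 2 := mul_le_mul' hk' le_rfl
        _ = s k * s k * w k ^ 2 := by ring
  have hw'le : ∑ k, w' k ^ 2 ≤ ∑ k, w k ^ 2 := by
    refine Finset.sum_le_sum fun k _ => ?_
    by_cases hk : s k ^ 2 < c * w k <;> simp [hw', hk]
  calc c * (∑ k, w k - ∑ k, if s k ^ 2 < c * w k then w k else 0) ^ 3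
      ≤ c * (∑ k, w' k) ^ 3 := by gcongr
    _ ≤ (∑ k, s k) * (∑ k, s k) * ∑ k, w' k ^ 2 := hH
    _ ≤ (∑ k, s k) ^ 2 * ∑ k, w k ^ 2 := by rw [← pow_two]; gcongr


end Summit.AtomisticToContinuum.BoseEinsteinCondensation.Theorems.TwoScaleGlueProof

end
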